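import Summits.CriticalPhenomena.PercolationContinuityZ3.Theorems.PercNearOneGluingNoHeavyLowerTailSahiCombTriWSandwich

/-!
# Conjecture DJ: PAIR-DIAGONAL sandwich certificates (point weights + antipodal-pair literals) — the typed target, and `DJ → TriWIneq`

Support file of the one-cut programme (crux `NoHeavyLowerTail`, stmt-CriticalPhenomena-4575; cell `prim-masterthm`, seat P5 gen 24; memo
`FROM-prim-masterthm-p5-g24-SANDWICH.md` §2, §5).  In the SANDWICH frame (`…SahiCombTriWSandwich`) the exact LP census of gen 24 (kit j169372 n ≤ 4 all up-sets; j169428 all 209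
S₅-classes of `2^5`; j170581/j170583) found that EVERY up-set `P` of `2^n`, `n ≤ 5`, has a certificate of the following two-weight shape (and no off-diagonal point pair is ever needed):

  `k(A,B) = Σ_u w(u)·[u ∈ A][u ∈ B] + Σ_u v(u)·[u ∈ A ∨ uᶜ ∈ A]·[u ∈ B ∨ uᶜ ∈ B]`,   `c·L_P ≤ k ≤ c·U_P` on all pairs of up-sets

— DIAGONAL point weights `w` (205 of the 209 classes at `n = 5` need nothing else) plus weights `v` on the ANTIPODAL PAIRS `{u, uᶜ}` through the pair-JOIN literal (needed exactly for
the `K₂₂`-type classes: 1 class at `n = 4`, 4 at `n = 5`).  This file types the shape: `FiveUpSet.PairDiagCert P c w v`, the principle **`triW_nonneg_of_pairDiagCert`** (the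
pair literal is a monotone one-family literal whose index-cube trace is `α_u ∪ α_{uᶜ}`, so each atom averages to a Kleitman gap), the CONJECTURE **`FiveUpSet.PairDiagonalKleitman`**
(every up-set of every cube has such a certificate; a sharpening of `PairLocalKleitman` of `…TriWPairLocalLit`) and **`triWIneq_of_pairDiagonalKleitman : PairDiagonalKleitman → TriWIneq`**.
HONEST LABEL: the principle and the reduction are proved (std axioms); `PairDiagonalKleitman` is a CONJECTURE (an obligation of our theory, never a fact), verified by exact LP
certificates for every up-set of `2^n`, `n ≤ 5`, OPEN beyond. [this work]
-/

namespace Summit.CriticalPhenomena.PercolationContinuityZ3.Theorems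

namespace FiveUpSet

open Finset

variable {β γ : Type} [DecidableEq β] [Fintype β] [DecidableEq γ] [Fintype γ]

/-- The point literal `[u ∈ A]`. [this work] -/
def ptLit (u : Finset γ) (A : Finset (Finset γ)) : Bool := decide (u ∈ A)

/-- The antipodal-pair JOIN literal `[u ∈ A ∨ uᶜ ∈ A]` ("`A` meets the pair `{u, uᶜ}`"). [this work] -/
def pairLit (u : Finset γ) (A : Finset (Finset γ)) : Bool := decide (u ∈ A ∨ uᶜ ∈ A)

omit [DecidableEq β] [Fintype β] [Fintype γ] in
/-- Point literals are monotone. [this work] -/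
theorem monoLit_ptLit (u : Finset γ) : MonoLit (ptLit u) := by
  intro A A' h hA
  unfold ptLit at hA ⊢
  rw [decide_eq_true_eq] at hA ⊢
  exact h hA

omit [DecidableEq β] [Fintype β] in
/-- Pair literals are monotone. [this work] -/
theorem monoLit_pairLit (u : Finset γ) : MonoLit (pairLit u) := by
  intro A A' h hA
  unfold pairLit at hA ⊢
  rw [decide_eq_true_eq] at hA ⊢
  rcases hA with hA | hA
  · exact Or.inl (h hA)
  · exact Or.inr (h hA)

/-- The PAIR-DIAGONAL bilinear form: `Σ_u w(u)[u∈A][u∈B] + Σ_u v(u)[u∈A ∨ uᶜ∈A][u∈B ∨ uᶜ∈B]`. [this work] -/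
def djVal (w v : Finset γ → ℕ) (A B : Finset (Finset γ)) : ℤ :=
  ∑ u : Finset γ, ((w u : ℤ) * bInd (ptLit u) A * bInd (ptLit u) B + (v u : ℤ) * bInd (pairLit u) A * bInd (pairLit u) B)

/-- **Pair-diagonal sandwich certificate** for `P`: for ALL up-sets `A, B`, `c·L_P(A,B) ≤ djVal w v A B ≤ c·U_P(A,B)`. [this work] -/
def PairDiagCert (P : Finset (Finset γ)) (c : ℕ) (w v : Finset γ → ℕ) : Prop :=
  ∀ A B : Finset (Finset γ), IsUpperSet (A : Set (Finset γ)) → IsUpperSet (B : Set (Finset γ)) →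
    (c : ℤ) * lForm P A B ≤ djVal w v A B ∧ djVal w v A B ≤ (c : ℤ) * uForm P A B

/-- **The pair-diagonal principle**: a pair-diagonal certificate with `c > 0` gives `0 ≤ triW P F G` for EVERY index cube and all monotone families of up-sets
(each atom averages over the index cube to a Kleitman gap: `sum_bInd_sub_nonneg` of `…TriWSandwich`). [this work] -/
theorem triW_nonneg_of_pairDiagCert {P : Finset (Finset γ)} {c : ℕ} {w v : Finset γ → ℕ}
    (hc : 0 < c) (hcert : PairDiagCert P c w v) (F G : Finset β → Finset (Finset γ))
    (hF : ∀ x, IsUpperSet (F x : Set (Finset γ))) (hG : ∀ x, IsUpperSet (G x : Set (Finset γ)))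
    (hFm : Monotone F) (hGm : Monotone G) :
    0 ≤ triW P F G := by
  have hmain : ∑ x : Finset β, (djVal w v (F x) (G x) - djVal w v (F xᶜ) (G x))
      ≤ ∑ x : Finset β, ((c : ℤ) * uForm P (F x) (G x) - (c : ℤ) * lForm P (F xᶜ) (G x)) := by
    refine sum_le_sum fun x _ => ?_
    have h1 := (hcert (F x) (G x) (hF x) (hG x)).2
    have h2 := (hcert (F xᶜ) (G x) (hF xᶜ) (hG x)).1
    linarith
  have hL : 0 ≤ ∑ x : Finset β, (djVal w v (F x) (G x) - djVal w v (F xᶜ) (G x)) := by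
    have hrw : ∑ x : Finset β, (djVal w v (F x) (G x) - djVal w v (F xᶜ) (G x))
        = ∑ u : Finset γ, ((w u : ℤ) * ∑ x : Finset β, (bInd (ptLit u) (F x) * bInd (ptLit u) (G x) - bInd (ptLit u) (F xᶜ) * bInd (ptLit u) (G x))
            + (v u : ℤ) * ∑ x : Finset β, (bInd (pairLit u) (F x) * bInd (pairLit u) (G x) - bInd (pairLit u) (F xᶜ) * bInd (pairLit u) (G x))) := by
      unfold djVal
      calc ∑ x : Finset β, (∑ u : Finset γ, ((w u : ℤ) * bInd (ptLit u) (F x) * bInd (ptLit u) (G x) + (v u : ℤ) * bInd (pairLit u) (F x) * bInd (pairLit u) (G x))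
              - ∑ u : Finset γ, ((w u : ℤ) * bInd (ptLit u) (F xᶜ) * bInd (ptLit u) (G x) + (v u : ℤ) * bInd (pairLit u) (F xᶜ) * bInd (pairLit u) (G x)))
          = ∑ x : Finset β, ∑ u : Finset γ, (((w u : ℤ) * bInd (ptLit u) (F x) * bInd (ptLit u) (G x) + (v u : ℤ) * bInd (pairLit u) (F x) * bInd (pairLit u) (G x))
              - ((w u : ℤ) * bInd (ptLit u) (F xᶜ) * bInd (ptLit u) (G x) + (v u : ℤ) * bInd (pairLit u) (F xᶜ) * bInd (pairLit u) (G x))) := by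
            refine sum_congr rfl fun x _ => ?_
            rw [← Finset.sum_sub_distrib]
        _ = ∑ u : Finset γ, ∑ x : Finset β, (((w u : ℤ) * bInd (ptLit u) (F x) * bInd (ptLit u) (G x) + (v u : ℤ) * bInd (pairLit u) (F x) * bInd (pairLit u) (G x))
              - ((w u : ℤ) * bInd (ptLit u) (F xᶜ) * bInd (ptLit u) (G x) + (v u : ℤ) * bInd (pairLit u) (F xᶜ) * bInd (pairLit u) (G x))) := sum_comm
        _ = _ := by
            refine sum_congr rfl fun u _ => ?_
            rw [mul_sum, mul_sum, ← sum_add_distrib]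
            refine sum_congr rfl fun x _ => ?_
            ring
    rw [hrw]
    refine sum_nonneg fun u _ => add_nonneg ?_ ?_
    · exact mul_nonneg (by exact_mod_cast Nat.zero_le _) (sum_bInd_sub_nonneg (monoLit_ptLit u) (monoLit_ptLit u) hFm hGm)
    · exact mul_nonneg (by exact_mod_cast Nat.zero_le _) (sum_bInd_sub_nonneg (monoLit_pairLit u) (monoLit_pairLit u) hFm hGm)
  have hR : ∑ x : Finset β, ((c : ℤ) * uForm P (F x) (G x) - (c : ℤ) * lForm P (F xᶜ) (G x)) = (c : ℤ) * triW P F G := by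
    rw [triW_eq_sum_uForm_sub_lForm, mul_sum]
    refine sum_congr rfl fun x _ => ?_
    ring
  have h2 : 0 ≤ (c : ℤ) * triW P F G := by rw [← hR]; exact hL.trans hmain
  have hc' : (0 : ℤ) < c := by exact_mod_cast hc
  nlinarith

/-- **Conjecture DJ** (`PairDiagonalKleitman`; CONJECTURE — an obligation of our theory, never a fact; memo §5).  Every up-set `P` of every finite cube `Finset γ` admits a
pair-diagonal sandwich certificate: `c > 0` and weights `w, v : Finset γ → ℕ` with `c·L_P ≤ djVal w v ≤ c·U_P` on all pairs of up-sets.  EVIDENCE: exact LP certificates of exactly this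
shape, verified in integer arithmetic on all `#Up(2^n)²` pairs, for EVERY up-set of `2^n`, `n ≤ 4`, and for all 209 `S₅`-classes of `2^5` (P5 gen 24, kit j169372/j169428/j170581/j170583;
`v = 0` except for the `K₂₂`-type classes).  Contains the proved strata: principal / self-dual / saturated / co-atoms (`w ≡ 1` or Formula A, `v = 0`).  OPEN in general. [this work] -/
@[conjecture] def PairDiagonalKleitman : Prop :=
  ∀ (γ : Type) [DecidableEq γ] [Fintype γ] (P : Finset (Finset γ)), IsUpperSet (P : Set (Finset γ)) →
    ∃ (c : ℕ) (w v : Finset γ → ℕ), 0 < c ∧ PairDiagCert P c w v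

/-- **`PairDiagonalKleitman → TriWIneq`**: conjecture DJ implies `TRI_W(a) ≥ 0` for every `a` (pair-diagonal principle). [this work] -/
theorem triWIneq_of_pairDiagonalKleitman (h : PairDiagonalKleitman) : TriWIneq := by
  intro β γ _ _ _ _ P F G hP hF hG hFm hGm
  obtain ⟨c, w, v, hc, hcert⟩ := h γ P hP
  exact triW_nonneg_of_pairDiagCert hc hcert F G hF hG hFm hGm


/-! ### Amendment (gen 24, 21:10Z): the pair literals must be allowed on RELATIVE antipodes — `PairJoinKleitman`

The `n = 6` principal-row LP probe of gen 24 (kit j171615 round 2; j173280 round 3) finds NO certificate of the `PairDiagCert` shape above (point weights + join/meet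
literals of `W`-ANTIPODAL pairs only) for the `K₂₂`-CYLINDER `(x₁ ∨ x₂)(x₄ ∨ x₅) ⊆ 2^6` (two free coordinates), already on the sub-system of pairs of PRINCIPAL up-sets —
so `PairDiagonalKleitman` exactly as typed above is PRESUMABLY FALSE from `n = 6` on (a floating-point LP infeasibility of a finite sub-system, recorded honestly here; not a
Lean refutation).  The reason is structural (memo §4a, cylinder lemma): lifting a certificate along free coordinates turns an antipodal pair `{y, Y ∖ y}` of the base cube
`Y` into a pair that is complementary only inside a FACE of the big cube (`{y, Y∖y}` on the bottom face, `{y+n, (Y∖y)+n}` on the top face).  The corrected two-weight shape carries the pair weights on arbitrary pairs `{u, u'}`: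
`k(A,B) = Σ_u w(u)[u∈A][u∈B] + Σ_{(u,u')} v(u,u')[u∈A ∨ u'∈A][u∈B ∨ u'∈B]` — still a non-negative combination of products of monotone ONE-family literals, so the
sandwich principle applies verbatim.  `PairJoinKleitman` below is the amended conjecture (it contains every certificate found for `n ≤ 5` and all their cylinder lifts). [this work]
-/

/-- The JOIN literal of a pair of points `[u ∈ A ∨ u' ∈ A]`. [this work] -/
def joinLit (u u' : Finset γ) (A : Finset (Finset γ)) : Bool := decide (u ∈ A ∨ u' ∈ A)

omit [DecidableEq β] [Fintype β] [Fintype γ] in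
/-- Join literals are monotone. [this work] -/
theorem monoLit_joinLit (u u' : Finset γ) : MonoLit (joinLit u u') := by
  intro A A' h hA
  unfold joinLit at hA ⊢
  rw [decide_eq_true_eq] at hA ⊢
  rcases hA with hA | hA
  · exact Or.inl (h hA)
  · exact Or.inr (h hA)

/-- The pair-join part with weights on arbitrary ordered pairs: `Σ_{(u,u')} v(u,u')[u∈A ∨ u'∈A][u∈B ∨ u'∈B]`. [this work] -/
def joinVal (v : Finset γ → Finset γ → ℕ) (A B : Finset (Finset γ)) : ℤ :=
  ∑ p : Finset γ × Finset γ, (v p.1 p.2 : ℤ) * bInd (joinLit p.1 p.2) A * bInd (joinLit p.1 p.2) B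

/-- The point + pair-join bilinear form: `djVal w 0` (points only) plus `joinVal v`. [this work] -/
def pjVal (w : Finset γ → ℕ) (v : Finset γ → Finset γ → ℕ) (A B : Finset (Finset γ)) : ℤ :=
  djVal w (fun _ => 0) A B + joinVal v A B

/-- **Point + pair-join sandwich certificate** for `P`. [this work] -/
def PairJoinCert (P : Finset (Finset γ)) (c : ℕ) (w : Finset γ → ℕ) (v : Finset γ → Finset γ → ℕ) : Prop :=
  ∀ A B : Finset (Finset γ), IsUpperSet (A : Set (Finset γ)) → IsUpperSet (B : Set (Finset γ)) →
    (c : ℤ) * lForm P A B ≤ pjVal w v A B ∧ pjVal w v A B ≤ (c : ℤ) * uForm P A B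

/-- The index-cube average of the pair-join part is a non-negative combination of Kleitman gaps. [this work] -/
theorem sum_joinVal_sub_nonneg (v : Finset γ → Finset γ → ℕ) {F G : Finset β → Finset (Finset γ)} (hFm : Monotone F) (hGm : Monotone G) :
    0 ≤ ∑ x : Finset β, (joinVal v (F x) (G x) - joinVal v (F xᶜ) (G x)) := by
  have hrw : ∑ x : Finset β, (joinVal v (F x) (G x) - joinVal v (F xᶜ) (G x))
      = ∑ p : Finset γ × Finset γ, (v p.1 p.2 : ℤ) * ∑ x : Finset β,
          (bInd (joinLit p.1 p.2) (F x) * bInd (joinLit p.1 p.2) (G x) - bInd (joinLit p.1 p.2) (F xᶜ) * bInd (joinLit p.1 p.2) (G x)) := by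
    unfold joinVal
    calc ∑ x : Finset β, (∑ p : Finset γ × Finset γ, (v p.1 p.2 : ℤ) * bInd (joinLit p.1 p.2) (F x) * bInd (joinLit p.1 p.2) (G x)
            - ∑ p : Finset γ × Finset γ, (v p.1 p.2 : ℤ) * bInd (joinLit p.1 p.2) (F xᶜ) * bInd (joinLit p.1 p.2) (G x))
        = ∑ x : Finset β, ∑ p : Finset γ × Finset γ, ((v p.1 p.2 : ℤ) * bInd (joinLit p.1 p.2) (F x) * bInd (joinLit p.1 p.2) (G x)
            - (v p.1 p.2 : ℤ) * bInd (joinLit p.1 p.2) (F xᶜ) * bInd (joinLit p.1 p.2) (G x)) := by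
          refine sum_congr rfl fun x _ => ?_
          rw [← Finset.sum_sub_distrib]
      _ = ∑ p : Finset γ × Finset γ, ∑ x : Finset β, ((v p.1 p.2 : ℤ) * bInd (joinLit p.1 p.2) (F x) * bInd (joinLit p.1 p.2) (G x)
            - (v p.1 p.2 : ℤ) * bInd (joinLit p.1 p.2) (F xᶜ) * bInd (joinLit p.1 p.2) (G x)) := sum_comm
      _ = _ := by
          refine sum_congr rfl fun p _ => ?_
          rw [mul_sum]
          refine sum_congr rfl fun x _ => ?_
          ring
  rw [hrw]
  exact sum_nonneg fun p _ => mul_nonneg (by exact_mod_cast Nat.zero_le _)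
    (sum_bInd_sub_nonneg (monoLit_joinLit p.1 p.2) (monoLit_joinLit p.1 p.2) hFm hGm)

/-- The index-cube average of the point part is a non-negative combination of Kleitman gaps. [this work] -/
theorem sum_djVal_pt_sub_nonneg (w : Finset γ → ℕ) {F G : Finset β → Finset (Finset γ)} (hFm : Monotone F) (hGm : Monotone G) :
    0 ≤ ∑ x : Finset β, (djVal w (fun _ => 0) (F x) (G x) - djVal w (fun _ => 0) (F xᶜ) (G x)) := by
  have hrw : ∑ x : Finset β, (djVal w (fun _ => 0) (F x) (G x) - djVal w (fun _ => 0) (F xᶜ) (G x))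
      = ∑ u : Finset γ, (w u : ℤ) * ∑ x : Finset β, (bInd (ptLit u) (F x) * bInd (ptLit u) (G x) - bInd (ptLit u) (F xᶜ) * bInd (ptLit u) (G x)) := by
    unfold djVal
    simp only [Nat.cast_zero, zero_mul, add_zero]
    calc ∑ x : Finset β, (∑ u : Finset γ, (w u : ℤ) * bInd (ptLit u) (F x) * bInd (ptLit u) (G x)
            - ∑ u : Finset γ, (w u : ℤ) * bInd (ptLit u) (F xᶜ) * bInd (ptLit u) (G x))
        = ∑ x : Finset β, ∑ u : Finset γ, ((w u : ℤ) * bInd (ptLit u) (F x) * bInd (ptLit u) (G x) - (w u : ℤ) * bInd (ptLit u) (F xᶜ) * bInd (ptLit u) (G x)) := by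
          refine sum_congr rfl fun x _ => ?_
          rw [← Finset.sum_sub_distrib]
      _ = ∑ u : Finset γ, ∑ x : Finset β, ((w u : ℤ) * bInd (ptLit u) (F x) * bInd (ptLit u) (G x) - (w u : ℤ) * bInd (ptLit u) (F xᶜ) * bInd (ptLit u) (G x)) := sum_comm
      _ = _ := by
          refine sum_congr rfl fun u _ => ?_
          rw [mul_sum]
          refine sum_congr rfl fun x _ => ?_
          ring
  rw [hrw]
  exact sum_nonneg fun u _ => mul_nonneg (by exact_mod_cast Nat.zero_le _) (sum_bInd_sub_nonneg (monoLit_ptLit u) (monoLit_ptLit u) hFm hGm)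

/-- **The point + pair-join principle**: a `PairJoinCert` with `c > 0` gives `0 ≤ triW P F G` for every index cube and all monotone families of up-sets. [this work] -/
theorem triW_nonneg_of_pairJoinCert {P : Finset (Finset γ)} {c : ℕ} {w : Finset γ → ℕ} {v : Finset γ → Finset γ → ℕ}
    (hc : 0 < c) (hcert : PairJoinCert P c w v) (F G : Finset β → Finset (Finset γ))
    (hF : ∀ x, IsUpperSet (F x : Set (Finset γ))) (hG : ∀ x, IsUpperSet (G x : Set (Finset γ)))
    (hFm : Monotone F) (hGm : Monotone G) :
    0 ≤ triW P F G := by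
  have hmain : ∑ x : Finset β, (pjVal w v (F x) (G x) - pjVal w v (F xᶜ) (G x))
      ≤ ∑ x : Finset β, ((c : ℤ) * uForm P (F x) (G x) - (c : ℤ) * lForm P (F xᶜ) (G x)) := by
    refine sum_le_sum fun x _ => ?_
    have h1 := (hcert (F x) (G x) (hF x) (hG x)).2
    have h2 := (hcert (F xᶜ) (G x) (hF xᶜ) (hG x)).1
    linarith
  have hL : 0 ≤ ∑ x : Finset β, (pjVal w v (F x) (G x) - pjVal w v (F xᶜ) (G x)) := by
    have hsplit : ∑ x : Finset β, (pjVal w v (F x) (G x) - pjVal w v (F xᶜ) (G x))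
        = ∑ x : Finset β, (djVal w (fun _ => 0) (F x) (G x) - djVal w (fun _ => 0) (F xᶜ) (G x))
          + ∑ x : Finset β, (joinVal v (F x) (G x) - joinVal v (F xᶜ) (G x)) := by
      unfold pjVal
      rw [← sum_add_distrib]
      refine sum_congr rfl fun x _ => ?_
      ring
    rw [hsplit]
    exact add_nonneg (sum_djVal_pt_sub_nonneg w hFm hGm) (sum_joinVal_sub_nonneg v hFm hGm)
  have hR : ∑ x : Finset β, ((c : ℤ) * uForm P (F x) (G x) - (c : ℤ) * lForm P (F xᶜ) (G x)) = (c : ℤ) * triW P F G := by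
    rw [triW_eq_sum_uForm_sub_lForm, mul_sum]
    refine sum_congr rfl fun x _ => ?_
    ring
  have h2 : 0 ≤ (c : ℤ) * triW P F G := by rw [← hR]; exact hL.trans hmain
  have hc' : (0 : ℤ) < c := by exact_mod_cast hc
  nlinarith

/-- **Conjecture DJ′** (`PairJoinKleitman`; CONJECTURE — an obligation of our theory, never a fact; memo §5/§9 amended).  Every up-set `P` of every finite cube admits a point +
pair-join sandwich certificate `PairJoinCert P c w v` with `c > 0` (pair weights on arbitrary pairs `{u, u'}`; the cylinder lifts of the known certificates use pairs that are
COMPLEMENTARY INSIDE A FACE of the cube, `u ∩ u' = s`, `u ∪ u' = t`).  EVIDENCE: every up-set of `2^n`, `n ≤ 5` (there even `W`-antipodal pairs suffice) and all cylinders over them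
(memo §4a); the `n = 6` principal-row probe with face-relative pairs is kit j173414 (running at the time of writing).  OPEN in general. [this work] -/
@[conjecture] def PairJoinKleitman : Prop :=
  ∀ (γ : Type) [DecidableEq γ] [Fintype γ] (P : Finset (Finset γ)), IsUpperSet (P : Set (Finset γ)) →
    ∃ (c : ℕ) (w : Finset γ → ℕ) (v : Finset γ → Finset γ → ℕ), 0 < c ∧ PairJoinCert P c w v

/-- **`PairJoinKleitman → TriWIneq`**. [this work] -/
theorem triWIneq_of_pairJoinKleitman (h : PairJoinKleitman) : TriWIneq := by
  intro β γ _ _ _ _ P F G hP hF hG hFm hGm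
  obtain ⟨c, w, v, hc, hcert⟩ := h γ P hP
  exact triW_nonneg_of_pairJoinCert hc hcert F G hF hG hFm hGm

end FiveUpSet

end Summit.CriticalPhenomena.PercolationContinuityZ3.Theorems
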